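import Summits.ValiantsHypothesis.ValiantsHypothesis.Theorems.GrenetZeonDualUnipotentThreeHalvesLongMassFreeTriangularPrice

/-!
# `GrenetZeon.DualUnipotentThreeHalves` (stmt-ValiantsHypothesis-24318), line `slow_core`, stub (c) `SlowCore.LongMassSlowLawInv`:
# THE BLOCK CERTIFICATE of the free triangular pencil — the matching UPPER bound `P ≤ n·k + (k+1)·C(⌈b/(k+1)⌉, 2)` (leading constant `√2`)

Completes the two-sided price computation begun in ✓ `…LongMassSeparatedProducts` / ✓ `…LongMassFreeTriangularPrice` (lower bound
`(P + n + 2b)² ≥ 2·n·b²` for EVERY certificate of the free triangular pencil `N_{ij} = x_{(ι i, ι j)}`).  The upper side of record for triangularisable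
rows is the BAND certificate (kill the diagonals `j − i < L`, ✓ `window_of_flag` / `relCert_of_acyclicSupport`, leading constant `2`); the optimal
certificate of `𝔫_b` is the BLOCK certificate: cut `[b]` into `k + 1` consecutive blocks, kill the coordinates of the same-block positions, keep
order `k` (a word with `> k` block-raising letters vanishes).

* ★ `relCert_of_blocks` — for ANY monotone block labelling `blk : Fin b → ℕ` with values `≤ k`:
  `RelCert n b N (n·k + #{(i, j) : i < j, blk i = blk j})` (direction space = the coordinate span off the same-block positions; degree bound by the
  reversed-level potential ✓ `SlowCore.totalDegree_pow_le_flagDeg_of_le` with `r = a = 0`, `p = k + 1` levels).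
* `card_sameBlock_le` — for `blk i = i / g`: `#{i < j same block} ≤ (#blocks)·C(g, 2)` (injection `(i, j) ↦ (i / g, {i % g, j % g})`).
* ★★★ `relCert_free_blocks` — **`RelCert n b 𝔫_b (n·k + (k+1)·C(⌈b/(k+1)⌉, 2))` for every `k`** (`⌈b/(k+1)⌉ = (b + k)/(k + 1)`).  At `k + 1 ≈ b/√(2n)`
  this is `√2·√n·b + O(n + b)`; with ✓ `two_mul_sq_le_of_relCert` (`P ≥ √2·√n·b − n − 2b`):  **the price of `𝔫_b` is `√2·√n·b` to leading order** —
  the model enemy of (c) is priced EXACTLY at the conjectured rate, from both sides, in the kernel.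

HONEST FRAMING.  Calibration (`--supports stmt-ValiantsHypothesis-24318`): a certificate for ONE cheap-by-(c)-standards family; (c)
`LongMassSlowLawInv` (∃ c) is RESEARCH — OPEN, neither proved nor refuted here; closes no stub; S3, 24318, 8062 (`stub_dualUnipotent`) and
`VP ≠ VNP` are NOT proved.  Def-free, no named facts, no sorry.  [folklore: block-parabolic truncation]
-/

set_option linter.dupNamespace false
set_option autoImplicit false

noncomputable section

namespace Summit.ValiantsHypothesis.ValiantsHypothesis.Theorems.GrenetZeon.FreeTriangularPrice

open MvPolynomial Matrix
open scoped BigOperators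
open Summit.ValiantsHypothesis.ValiantsHypothesis.Cruxes.TwoDimCoefficients.DimTwoCases (AffMat IsAffine)
open Summit.ValiantsHypothesis.ValiantsHypothesis.Theorems.GrenetZeon.RadicalSplit (lineSubst)
open Summit.ValiantsHypothesis.ValiantsHypothesis.Theorems.GrenetZeon.SlowCore
  (linEntry Ledger RelCert lineSubst_apply_of_le_one totalDegree_lineSubst_le_one totalDegree_pow_le_flagDeg_of_le)
open Summit.ValiantsHypothesis.ValiantsHypothesis.Theorems.GrenetZeon.ResolventFlag (pointMat linMat)
open Summit.ValiantsHypothesis.ValiantsHypothesis.Theorems.GrenetZeon.InitialForm.SlowTorus (finrank_span_single)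

variable {n b : ℕ}

/-! ## §1 The block certificate for an arbitrary monotone block labelling -/

open Classical in
/-- ★ **BLOCK CERTIFICATE.**  For the free triangular pencil and a monotone block labelling `blk` with values `≤ k`: killing the coordinates of the
same-block positions `{(i, j) : i < j, blk i = blk j}` and keeping order `k` is a whole-pencil certificate; price `n·k + #(same-block positions)`. -/
theorem relCert_of_blocks (ι : Fin b → Fin n) (hι : Function.Injective ι) (N : AffMat n b)
    (hN : ∀ i j, N i j = if i < j then X (ι i, ι j) else 0) (k : ℕ) (blk : Fin b → ℕ)
    (hmono : ∀ i j : Fin b, i ≤ j → blk i ≤ blk j) (hk : ∀ i, blk i ≤ k) :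
    RelCert n b N (n * k + ((Finset.univ : Finset (Fin b × Fin b)).filter (fun p => p.1 < p.2 ∧ blk p.1 = blk p.2)).card) := by
  classical
  set S := (Finset.univ : Finset (Fin b × Fin b)).filter (fun p => p.1 < p.2 ∧ blk p.1 = blk p.2) with hS
  set φ : Fin b × Fin b → Fin n × Fin n := fun p => (ι p.1, ι p.2) with hφ
  have hφinj : Function.Injective φ := fun p q h => by
    obtain ⟨h1, h2⟩ := Prod.mk.inj h
    exact Prod.ext (hι h1) (hι h2)
  set D := S.image φ with hD
  have hDcard : D.card = S.card := Finset.card_image_of_injective _ hφinj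
  set K : Submodule ℂ (Fin n × Fin n → ℂ) :=
    Submodule.span ℂ (Set.range fun e : (Dᶜ : Finset (Fin n × Fin n)) => (Pi.single (e : Fin n × Fin n) (1 : ℂ) : Fin n × Fin n → ℂ)) with hK
  have hKdim : Module.finrank ℂ K = (Dᶜ).card := finrank_span_single _
  -- directions in `K` vanish on the dead coordinates
  have hdead : ∀ v ∈ K, ∀ c ∈ D, v c = 0 := by
    intro v hv c hc
    have hle : K ≤ LinearMap.ker (LinearMap.proj c : (Fin n × Fin n → ℂ) →ₗ[ℂ] ℂ) := by
      rw [hK, Submodule.span_le]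
      rintro _ ⟨⟨e, he⟩, rfl⟩
      rw [SetLike.mem_coe, LinearMap.mem_ker, LinearMap.proj_apply]
      change (Pi.single e (1 : ℂ) : Fin n × Fin n → ℂ) c = 0
      rw [Pi.single_apply, if_neg]
      rintro rfl
      exact (Finset.mem_compl.mp he) hc
    simpa using hle hv
  have haff := isAffine_free ι N hN
  refine ⟨K, k, ?_, ?_⟩
  · -- the window: reversed block index as a level function, `r = a = 0`, `k + 1` levels
    intro x v hv p hp i j _ _
    set M := N.map (lineSubst x v) with hM
    have hbound := totalDegree_pow_le_flagDeg_of_le (fun i => k - blk i) (k + 1) 0 0 n p hp (fun i => by omega) M ?_ i j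
    · simpa using hbound
    intro i' j' d hd
    -- affine entries: `d 0 ≤ 1`
    have hdeg1 : d 0 ≤ 1 := by
      have hmem : d ∈ (M i' j').support := mem_support_iff.mpr hd
      have h1 := le_totalDegree hmem
      have h2 : (M i' j').totalDegree ≤ 1 := by rw [hM, Matrix.map_apply]; exact totalDegree_lineSubst_le_one x v (haff i' j')
      have hsum : (d.sum fun _ e => e) = d 0 := by rw [Finsupp.sum_fintype _ _ (fun _ => rfl)]; simp
      omega
    have hentry : M i' j' = C (pointMat N x i' j') + C (linMat N v i' j') * X 0 := by
      rw [hM, Matrix.map_apply, lineSubst_apply_of_le_one N haff x v i' j']; rfl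
    by_cases hw : linMat N v i' j' = 0
    · -- constant entry: `d = 0`, and a non-zero value needs `i' < j'`
      rw [hentry, hw, C_0, zero_mul, add_zero, coeff_C] at hd
      split_ifs at hd with h0
      · subst h0
        have hij : i' < j' := by
          by_contra hcon
          rw [pointMat_free ι N hN, if_neg hcon] at hd
          exact hd rfl
        have := hmono i' j' hij.le
        have := hk j'
        simp only [Finsupp.coe_zero, Pi.zero_apply, mul_zero, zero_add, add_zero, ge_iff_le]
        omega
      · exact absurd rfl hd
    · -- moving entry: `i' < j'` in DIFFERENT blocks (same-block coordinates are dead on `K`)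
      have hij : i' < j' := by
        by_contra hcon
        rw [linMat_free ι N hN, if_neg hcon] at hw
        exact hw rfl
      have hne : blk i' ≠ blk j' := by
        intro heq
        apply hw
        rw [linMat_free ι N hN, if_pos hij]
        exact hdead v hv _ (Finset.mem_image.mpr ⟨(i', j'), Finset.mem_filter.mpr ⟨Finset.mem_univ _, hij, heq⟩, rfl⟩)
      have hlt : blk i' < blk j' := lt_of_le_of_ne (hmono i' j' hij.le) hne
      have := hk j'
      simp only [zero_add, one_mul, add_zero, ge_iff_le]
      omega
  · -- the price
    have hcompl : (Dᶜ).card = n * n - D.card := by rw [Finset.card_compl, Fintype.card_prod, Fintype.card_fin]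
    have hDle : D.card ≤ n * n := by
      calc D.card ≤ Fintype.card (Fin n × Fin n) := Finset.card_le_univ _
        _ = n * n := by rw [Fintype.card_prod, Fintype.card_fin]
    rw [hKdim, hcompl, hDcard]
    rw [hDcard] at hDle
    omega

/-! ## §2 Consecutive blocks of size `g`: the same-block count and the certificate of record -/

open Classical in
/-- Same-block positions for `blk i = i / g` inject into `(block, 2-subset of offsets)`: at most `B·C(g, 2)` of them when all blocks are `< B`. -/
theorem card_sameBlock_le (g B : ℕ) (hg : 0 < g) (hB : ∀ i : Fin b, (i : ℕ) / g < B) :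
    ((Finset.univ : Finset (Fin b × Fin b)).filter (fun p => p.1 < p.2 ∧ (p.1 : ℕ) / g = (p.2 : ℕ) / g)).card ≤ B * Nat.choose g 2 := by
  classical
  set S := (Finset.univ : Finset (Fin b × Fin b)).filter (fun p => p.1 < p.2 ∧ (p.1 : ℕ) / g = (p.2 : ℕ) / g) with hS
  set T := (Finset.range B) ×ˢ (Finset.powersetCard 2 (Finset.range g)) with hT
  have hTcard : T.card = B * Nat.choose g 2 := by
    rw [hT, Finset.card_product, Finset.card_range, Finset.card_powersetCard, Finset.card_range]
  rw [← hTcard]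
  -- same block and `i < j` force distinct offsets `i % g < j % g`
  have hoff : ∀ p ∈ S, (p.1 : ℕ) % g < (p.2 : ℕ) % g := by
    intro p hp
    obtain ⟨h1, h2⟩ := (Finset.mem_filter.mp hp).2
    have e1 := Nat.div_add_mod (p.1 : ℕ) g
    have e2 := Nat.div_add_mod (p.2 : ℕ) g
    have h1' : (p.1 : ℕ) < p.2 := h1
    rw [h2] at e1
    omega
  refine Finset.card_le_card_of_injOn (fun p => ((p.1 : ℕ) / g, ({(p.1 : ℕ) % g, (p.2 : ℕ) % g} : Finset ℕ))) (fun p hp => ?_)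
    (fun p hp q hq h => ?_)
  · rw [Finset.mem_coe, hT, Finset.mem_product, Finset.mem_range, Finset.mem_powersetCard]
    refine ⟨hB p.1, ?_, Finset.card_pair (ne_of_lt (hoff p hp))⟩
    intro a ha
    rw [Finset.mem_insert, Finset.mem_singleton] at ha
    rw [Finset.mem_range]
    rcases ha with rfl | rfl
    · exact Nat.mod_lt _ hg
    · exact Nat.mod_lt _ hg
  · obtain ⟨hb1, hs⟩ := Prod.mk.inj h
    have hp' := hoff p hp
    have hq' := hoff q hq
    obtain ⟨-, hpblk⟩ := (Finset.mem_filter.mp hp).2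
    obtain ⟨-, hqblk⟩ := (Finset.mem_filter.mp hq).2
    -- equal 2-sets with ordered elements have equal smaller / larger elements
    have hmin : (p.1 : ℕ) % g = (q.1 : ℕ) % g := by
      have h1 : (p.1 : ℕ) % g ∈ ({(q.1 : ℕ) % g, (q.2 : ℕ) % g} : Finset ℕ) := by rw [← hs]; simp
      have h2 : (q.1 : ℕ) % g ∈ ({(p.1 : ℕ) % g, (p.2 : ℕ) % g} : Finset ℕ) := by rw [hs]; simp
      simp only [Finset.mem_insert, Finset.mem_singleton] at h1 h2
      omega
    have hmax : (p.2 : ℕ) % g = (q.2 : ℕ) % g := by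
      have h1 : (p.2 : ℕ) % g ∈ ({(q.1 : ℕ) % g, (q.2 : ℕ) % g} : Finset ℕ) := by rw [← hs]; simp
      have h2 : (q.2 : ℕ) % g ∈ ({(p.1 : ℕ) % g, (p.2 : ℕ) % g} : Finset ℕ) := by rw [hs]; simp
      simp only [Finset.mem_insert, Finset.mem_singleton] at h1 h2
      omega
    have e1 := Nat.div_add_mod (p.1 : ℕ) g
    have e2 := Nat.div_add_mod (q.1 : ℕ) g
    have e3 := Nat.div_add_mod (p.2 : ℕ) g
    have e4 := Nat.div_add_mod (q.2 : ℕ) g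
    have hv1 : (p.1 : ℕ) = q.1 := by rw [← e1, ← e2, hb1, hmin]
    have hv2 : (p.2 : ℕ) = q.2 := by rw [← e3, ← e4, ← hpblk, ← hqblk, hb1, hmax]
    exact Prod.ext (Fin.ext hv1) (Fin.ext hv2)

/-- ★★★ **THE CERTIFICATE OF RECORD FOR `𝔫_b`: `RelCert n b N (n·k + (k+1)·C(⌈b/(k+1)⌉, 2))` for every order `k`** (consecutive blocks of size
`g = ⌈b/(k+1)⌉ = (b + k)/(k + 1)`).  With ✓ `two_mul_sq_le_of_relCert` the price of the free triangular pencil is pinned between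
`√2·√n·b − n − 2b` and `min_k (n·k + (k+1)·C(⌈b/(k+1)⌉, 2)) = √2·√n·b + O(n + b)`. -/
theorem relCert_free_blocks (ι : Fin b → Fin n) (hι : Function.Injective ι) (N : AffMat n b)
    (hN : ∀ i j, N i j = if i < j then X (ι i, ι j) else 0) (k : ℕ) :
    RelCert n b N (n * k + (k + 1) * Nat.choose ((b + k) / (k + 1)) 2) := by
  classical
  set g := (b + k) / (k + 1) with hg
  rcases Nat.eq_zero_or_pos b with hb | hb
  · -- no positions at all
    subst hb
    obtain ⟨K, k', hK, hP⟩ := relCert_of_blocks ι hι N hN k (fun _ => 0) (fun _ _ _ => le_rfl) (fun _ => Nat.zero_le _)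
    refine ⟨K, k', hK, le_trans hP ?_⟩
    gcongr
    · exact Nat.zero_le _
  · have hg0 : 0 < g := by
      rw [hg]; exact Nat.div_pos (by omega) (by omega)
    have hgk : b ≤ g * (k + 1) := by
      have := Nat.div_add_mod (b + k) (k + 1)
      have := Nat.mod_lt (b + k) (show 0 < k + 1 by omega)
      rw [hg, mul_comm]
      omega
    have hblk : ∀ i : Fin b, (i : ℕ) / g ≤ k := by
      intro i
      have hi : (i : ℕ) < g * (k + 1) := lt_of_lt_of_le i.2 hgk
      exact Nat.lt_succ_iff.mp ((Nat.div_lt_iff_lt_mul hg0).mpr (by simpa [mul_comm] using hi))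
    obtain ⟨K, k', hK, hP⟩ := relCert_of_blocks ι hι N hN k (fun i => (i : ℕ) / g)
      (fun i j hij => Nat.div_le_div_right (Fin.le_def.mp hij)) hblk
    refine ⟨K, k', hK, le_trans hP ?_⟩
    have := card_sameBlock_le (b := b) g (k + 1) hg0 (fun i => Nat.lt_succ_of_le (hblk i))
    omega

end Summit.ValiantsHypothesis.ValiantsHypothesis.Theorems.GrenetZeon.FreeTriangularPrice

end
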